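import Literature.NumberTheory.EllipticCurves.PAdicPowerSeriesZeros
import Summits.BirchSwinnertonDyer.Rank1Residual.X1.MuLambdaAlgebra
import Mathlib.RingTheory.Polynomial.Eisenstein.IsIntegral
import Mathlib.RingTheory.Polynomial.GaussLemma
import HarnessLib

/-!
# A zero of `G ∈ Λ = ℤ_p⟦T⟧` at `ζ − 1`, `ζ` a primitive `pⁿ⁺¹`-th root of unity, costs `φ(pⁿ⁺¹)`
# units of `λ`-invariant: `G(ζ − 1) = 0 ⇒ φ(pⁿ⁺¹) ≤ λ(G)`
# (cell `b2b-bsdres`; class-agnostic kernel support for the (μ, λ) censuses of iw-1 / iw-2; prover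
# unit `b2b-bsdres-additive-p3`, gen 7)

HONEST FRAMING (run/shared/lean/b2b/bsd-rank1-residual/, verbatim in every file): the goal of the
cell is to DELETE the COMBINATION-SHAPED residual classes of the Birch–Swinnerton-Dyer formula for
ALL analytic-rank `≤ 1` elliptic curves over `ℚ` — "full BSD formula for every rank `≤ 1` curve in
class `C`" assembled STRICTLY from published theorems — so that the rank-`≤ 1` remainder becomes
exactly the CONSTRUCTION-SHAPED classes, which are TYPED (missing-input `Prop`s), NOT attempted.
This is not "finishing BSD". THEOREMS ONLY (pure `p`-adic algebra); no named fact; nothing about any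
curve is asserted; nothing booked; no label changes.

## What this file proves

Gen 6 of this unit read the non-vanishing of the twisted central values `L(E, χ, 1)` for the
characters `χ` of `Gal(ℚ_∞/ℚ)` out of ONE Mazur–Tate certificate (`μ(θ_n) = 0`, `λ(θ_n) < φ(pⁿ)`),
using that `θ_n` has RATIONAL coefficients (`Φ_{pⁿ}(X+1)` is the minimal polynomial of `ζ − 1`
over `ℚ`). The present file proves the underlying statement for an ARBITRARY element of the
Iwasawa algebra, with no rationality and no `μ = 0` hypothesis, so that it applies verbatim to the
`p`-adic `L`-function `L_p(E, T)` at a good ORDINARY or a MULTIPLICATIVE prime (classes X1, X2, X4,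
X9, X10, X11 of the cell; iw-1's census of `(μ_an, λ_an)`):

* §1 `Φ_{pⁿ⁺¹}(X + 1)` is irreducible over `ℚ_p` (Eisenstein at `(p) ⊂ ℤ_p`, Mathlib's criterion over
  `ℤ` transported to `ℤ_p`, Gauss's lemma for the monic polynomial over the integrally closed `ℤ_p`)
  and is the minimal polynomial over `ℚ_p` of `ζ − 1` for every primitive `pⁿ⁺¹`-th root of unity
  `ζ ∈ ℂ_p` (`minpoly_sub_one_eq_cyclotomic_comp`); hence a polynomial `P ∈ ℤ_p[X]`, `P ≠ 0`, with
  `P(ζ − 1) = 0` has `deg P ≥ φ(pⁿ⁺¹)` (`totient_le_natDegree_of_isRoot`).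
* §2 **`totient_le_lam_of_hasSum_zero`**: for `G ∈ Λ`, `G ≠ 0`, if `∑_k G_k (ζ − 1)^k = 0` in `ℂ_p`
  then `φ(pⁿ⁺¹) ≤ λ(G)` — by the `p`-adic Weierstrass preparation theorem `G = p^μ · P · U` (Mathlib
  `eq_weierstrassDistinguished_mul_weierstrassUnit` after the tree's `p`-content extraction), the
  zero is a root of the distinguished polynomial `P`, and `deg P = λ(G)` (the tree's `lam` of
  `X1.MuLambdaAlgebra` IS the degree of the Weierstrass polynomial: `natDegree_eq_toNat_order_map`).
  Equivalently: `λ(G) < φ(pⁿ⁺¹)` ⇒ `G` does not vanish at any `ζ − 1` with `ζ` of order `pⁿ⁺¹`; and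
  `λ(G) < p − 1` ⇒ `G` vanishes at NO point `ζ − 1`, `ζ ∈ μ_{p^∞} ∖ {1}` (`hasSum_ne_zero_of_lam_lt`).
  (Classically: a non-zero element of `Λ` has exactly `λ` zeros in the open unit disc counted with
  multiplicity — Washington, GTM 83, §7.1–7.2; only the inequality for these special points is needed
  and proved here.)

The arithmetic consumers (`p`-adic `L`-functions with the Mazur–Tate–Teitelbaum interpolation
property at good ordinary and multiplicative primes; Sprung's `L♯/L♭`; twisted `L`-values and
Kato's no-growth theorem along the tower) are in the sibling file
`Iwasawa/LambdaInvariantTwistedNonvanishing.lean`.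

References: [Washington1997] §7.1–7.2, Thm. 7.3; [Lang1990] Ch. 5 §2 Thm. 2.2;
[MazurTateTeitelbaum1986Invent] §I.12–I.14; HOME/b2b-bsdres-additive-p3/X8-ROUTE-B.md §12 (gen 7).
-/

set_option autoImplicit false

noncomputable section

open scoped Classical

open Polynomial Literature.NumberTheory.EllipticCurves
  Summit.BirchSwinnertonDyer.Rank1Residual.X1.MuLambda

namespace Summit.BirchSwinnertonDyer.Rank1Residual.Iwasawa

variable {p : ℕ} [hp : Fact p.Prime]

/-! ## §1. `Φ_{pⁿ⁺¹}(X + 1)` is the minimal polynomial of `ζ − 1` over `ℚ_p` -/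

section Minpoly

/-- The shifted cyclotomic polynomial `Φ_{pⁿ⁺¹}(X + 1) ∈ ℤ_p[X]` (base-changed from `ℤ`). [folklore] -/
theorem map_cyclotomic_comp_X_add_one (n : ℕ) :
    ((cyclotomic (p ^ (n + 1)) ℤ).comp (X + 1)).map (Int.castRingHom ℤ_[p]) =
      (cyclotomic (p ^ (n + 1)) ℤ_[p]).comp (X + 1) := by
  rw [map_comp, map_cyclotomic, Polynomial.map_add, map_X, Polynomial.map_one]

/-- `Φ_{pⁿ⁺¹}(X + 1) ∈ ℤ_p[X]` is monic. [folklore] -/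
theorem monic_cyclotomic_comp_X_add_one (n : ℕ) :
    ((cyclotomic (p ^ (n + 1)) ℤ_[p]).comp (X + 1)).Monic := by
  rw [show (X + 1 : ℤ_[p][X]) = X + C 1 by rw [C_1]]
  exact (cyclotomic.monic _ _).comp (monic_X_add_C 1) (by rw [natDegree_X_add_C]; exact one_ne_zero)

/-- `deg Φ_{pⁿ⁺¹}(X + 1) = φ(pⁿ⁺¹)` over any ring. [folklore] -/
theorem natDegree_cyclotomic_comp_X_add_one {R : Type*} [CommRing R] [IsDomain R] (m : ℕ) :
    ((cyclotomic m R).comp (X + 1)).natDegree = Nat.totient m := by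
  rw [natDegree_comp, natDegree_cyclotomic, ← C_1, natDegree_X_add_C, mul_one]

/-- **`Φ_{pⁿ⁺¹}(X + 1)` is Eisenstein at the maximal ideal `(p)` of `ℤ_p`** (Mathlib's
`cyclotomic_prime_pow_comp_X_add_one_isEisensteinAt` over `ℤ`, transported along `ℤ → ℤ_p`; the
constant coefficient is `Φ_{pⁿ⁺¹}(1) = p ∉ (p)²`). [folklore] -/
theorem isEisensteinAt_cyclotomic_comp_X_add_one (n : ℕ) :
    ((cyclotomic (p ^ (n + 1)) ℤ_[p]).comp (X + 1)).IsEisensteinAt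
      (IsLocalRing.maximalIdeal ℤ_[p]) := by
  have hP : p.Prime := hp.out
  set QZ : ℤ[X] := (cyclotomic (p ^ (n + 1)) ℤ).comp (X + 1) with hQZ
  have hZ : QZ.IsEisensteinAt (Submodule.span ℤ {(p : ℤ)}) :=
    cyclotomic_prime_pow_comp_X_add_one_isEisensteinAt p n
  have hmap : QZ.map (Int.castRingHom ℤ_[p]) = (cyclotomic (p ^ (n + 1)) ℤ_[p]).comp (X + 1) :=
    map_cyclotomic_comp_X_add_one n
  have hmonic := monic_cyclotomic_comp_X_add_one (p := p) n
  have hmonicZ : QZ.Monic := by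
    rw [hQZ, show (X + 1 : ℤ[X]) = X + C 1 by rw [C_1]]
    exact (cyclotomic.monic _ _).comp (monic_X_add_C 1) (by rw [natDegree_X_add_C]; exact one_ne_zero)
  have hdeg : ((cyclotomic (p ^ (n + 1)) ℤ_[p]).comp (X + 1)).natDegree = QZ.natDegree := by
    rw [← hmap, hmonicZ.natDegree_map]
  refine ⟨?_, fun {k} hk ↦ ?_, ?_⟩
  · -- leading coefficient `1 ∉ 𝔪`
    rw [hmonic.leadingCoeff]
    exact (IsLocalRing.maximalIdeal.isMaximal ℤ_[p]).ne_top ∘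
      (Ideal.eq_top_of_isUnit_mem _ · isUnit_one)
  · -- lower coefficients: `p ∣` them over `ℤ`
    rw [← hmap, coeff_map, PadicInt.maximalIdeal_eq_span_p, Ideal.mem_span_singleton]
    have hk' : k < QZ.natDegree := by rwa [hdeg] at hk
    have hmem : (p : ℤ) ∣ QZ.coeff k := Ideal.mem_span_singleton.mp (hZ.mem hk')
    obtain ⟨c, hc⟩ := hmem
    exact ⟨(c : ℤ_[p]), by rw [hc, map_mul, eq_intCast, eq_intCast, Int.cast_natCast]⟩
  · -- constant coefficient `Φ(1) = p ∉ 𝔪² = (p²)`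
    rw [coeff_zero_eq_eval_zero, eval_comp, eval_add, eval_X, eval_one, zero_add,
      eval_one_cyclotomic_prime_pow, PadicInt.maximalIdeal_eq_span_p, Ideal.span_singleton_pow,
      Ideal.mem_span_singleton]
    rintro ⟨c, hc⟩
    have h1 : (p : ℤ_[p]) * (1 - (p : ℤ_[p]) * c) = 0 := by rw [mul_sub, mul_one, ← mul_assoc, ← sq, ← hc, sub_self]
    have hp0 : (p : ℤ_[p]) ≠ 0 := Nat.cast_ne_zero.mpr hP.ne_zero
    have h2 : (p : ℤ_[p]) * c = 1 := by
      have := (mul_eq_zero.mp h1).resolve_left hp0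
      rwa [sub_eq_zero, eq_comm] at this
    have hunit : IsUnit (p : ℤ_[p]) := isUnit_iff_exists_inv.mpr ⟨c, h2⟩
    have hlt : ‖(p : ℤ_[p])‖ < 1 := by
      rw [PadicInt.norm_p]; exact inv_lt_one_of_one_lt₀ (by exact_mod_cast hP.one_lt)
    exact (PadicInt.isUnit_iff.mp hunit).not_lt hlt

/-- **`Φ_{pⁿ⁺¹}(X + 1)` is irreducible over `ℚ_p`** (Eisenstein over `ℤ_p` + Gauss's lemma for a
monic polynomial over the integrally closed domain `ℤ_p`). [folklore] -/
theorem irreducible_cyclotomic_comp_X_add_one (n : ℕ) :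
    Irreducible ((cyclotomic (p ^ (n + 1)) ℚ_[p]).comp (X + 1)) := by
  have hmonic := monic_cyclotomic_comp_X_add_one (p := p) n
  have hirr : Irreducible ((cyclotomic (p ^ (n + 1)) ℤ_[p]).comp (X + 1)) :=
    (isEisensteinAt_cyclotomic_comp_X_add_one n).irreducible
      (IsLocalRing.maximalIdeal.isMaximal ℤ_[p]).isPrime hmonic.isPrimitive
      (by rw [natDegree_cyclotomic_comp_X_add_one]; exact Nat.totient_pos.mpr (pow_pos hp.out.pos _))
  have h := (hmonic.irreducible_iff_irreducible_map_fraction_map (K := ℚ_[p])).mp hirr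
  rwa [map_comp, map_cyclotomic, Polynomial.map_add, map_X, Polynomial.map_one] at h

/-- **`Φ_{pⁿ⁺¹}(X + 1)` is the minimal polynomial of `ζ − 1` over `ℚ_p`** for every primitive
`pⁿ⁺¹`-th root of unity `ζ ∈ ℂ_p`. [folklore] -/
theorem minpoly_sub_one_eq_cyclotomic_comp {n : ℕ} {ζ : ℂ_[p]} (hζ : IsPrimitiveRoot ζ (p ^ (n + 1))) :
    minpoly ℚ_[p] (ζ - 1) = (cyclotomic (p ^ (n + 1)) ℚ_[p]).comp (X + 1) := by
  haveI : NeZero ((p ^ (n + 1) : ℕ) : ℂ_[p]) := ⟨Nat.cast_ne_zero.mpr (pow_ne_zero _ hp.out.ne_zero)⟩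
  have hmonic : ((cyclotomic (p ^ (n + 1)) ℚ_[p]).comp (X + 1)).Monic := by
    rw [show (X + 1 : ℚ_[p][X]) = X + C 1 by rw [C_1]]
    exact (cyclotomic.monic _ _).comp (monic_X_add_C 1) (by rw [natDegree_X_add_C]; exact one_ne_zero)
  refine (minpoly.eq_of_irreducible_of_monic (irreducible_cyclotomic_comp_X_add_one n) ?_ hmonic).symm
  have hroot : (cyclotomic (p ^ (n + 1)) ℂ_[p]).IsRoot ζ := (isRoot_cyclotomic_iff).mpr hζ
  rw [aeval_comp, aeval_add, aeval_X, aeval_one, sub_add_cancel, aeval_def, ← eval_map,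
    map_cyclotomic]
  exact hroot

/-- **A non-zero `P ∈ ℤ_p[X]` vanishing at `ζ − 1` has degree `≥ φ(pⁿ⁺¹)`.** [folklore] -/
theorem totient_le_natDegree_of_isRoot {n : ℕ} {ζ : ℂ_[p]} (hζ : IsPrimitiveRoot ζ (p ^ (n + 1)))
    {P : ℤ_[p][X]} (hP0 : P ≠ 0)
    (hroot : (P.map ((algebraMap ℚ_[p] ℂ_[p]).comp (algebraMap ℤ_[p] ℚ_[p]))).IsRoot (ζ - 1)) :
    Nat.totient (p ^ (n + 1)) ≤ P.natDegree := by
  set PQ : ℚ_[p][X] := P.map (algebraMap ℤ_[p] ℚ_[p]) with hPQ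
  have hPQ0 : PQ ≠ 0 := by
    rw [hPQ, Ne, Polynomial.map_eq_zero_iff (IsFractionRing.injective ℤ_[p] ℚ_[p])]
    exact hP0
  have haeval : aeval (ζ - 1) PQ = 0 := by
    rw [aeval_def, ← eval_map, hPQ, Polynomial.map_map]
    exact hroot
  have hdvd : minpoly ℚ_[p] (ζ - 1) ∣ PQ := minpoly.dvd ℚ_[p] (ζ - 1) haeval
  have hdeg := natDegree_le_of_dvd hdvd hPQ0
  rw [minpoly_sub_one_eq_cyclotomic_comp hζ, natDegree_cyclotomic_comp_X_add_one] at hdeg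
  rwa [hPQ, natDegree_map_eq_of_injective (IsFractionRing.injective ℤ_[p] ℚ_[p])] at hdeg

end Minpoly

/-! ## §2. A zero at `ζ − 1` forces `λ ≥ φ(pⁿ⁺¹)` -/

section Zeros

/-- **`λ(G)` is the degree of the Weierstrass polynomial of the `p`-free part of `G`.** If
`G = p^m · G'` with `G' ≢ 0 (mod p)`, then `λ(G) = deg P` for the distinguished polynomial `P` of
`G'` (Weierstrass preparation, Mathlib; `lam` of `X1.MuLambdaAlgebra`). [cite: Washington1997, §7.1–7.2 and Thm. 7.3] -/
theorem lam_eq_natDegree_weierstrassDistinguished {G G' : IwasawaAlgebra p} {m : ℕ}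
    (hGG' : G = PowerSeries.C ((p : ℤ_[p]) ^ m) * G')
    (hG' : G'.map (IsLocalRing.residue ℤ_[p]) ≠ 0) :
    lam G = (G'.weierstrassDistinguished hG').natDegree := by
  have hpf : pfree G = G' := (mu_eq_and_pfree_eq (g := G) hG' hGG').2
  rw [lam, hpf, (G'.isWeierstrassFactorization_weierstrassDistinguished_weierstrassUnit
    hG').natDegree_eq_toNat_order_map]

/-- **A zero of `G ∈ Λ ∖ {0}` at `ζ − 1`, `ζ ∈ ℂ_p` a primitive `pⁿ⁺¹`-th root of unity, forces
`φ(pⁿ⁺¹) ≤ λ(G)`.** Write `G = p^m · P · U` (`p`-content, then Weierstrass preparation: `P`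
distinguished of degree `λ(G)`, `U ∈ Λˣ`); evaluation at `|z| < 1` is multiplicative and `U(z) ≠ 0`,
so `P(ζ − 1) = 0`, and §1 gives `deg P ≥ φ(pⁿ⁺¹)`. No hypothesis on `μ(G)`.
[cite: Washington1997, §7.1–7.2 and Thm. 7.3] [cite: Lang1990, Ch. 5 §2 Thm. 2.2 (PDF p. 97)] -/
theorem totient_le_lam_of_hasSum_zero {G : IwasawaAlgebra p} (hG0 : G ≠ 0) {n : ℕ} {ζ : ℂ_[p]}
    (hζ : IsPrimitiveRoot ζ (p ^ (n + 1)))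
    (hsum : HasSum (fun k ↦ ((algebraMap ℚ_[p] ℂ_[p]).comp (algebraMap ℤ_[p] ℚ_[p]))
      (PowerSeries.coeff k G) * (ζ - 1) ^ k) 0) :
    Nat.totient (p ^ (n + 1)) ≤ lam G := by
  set ιZ : ℤ_[p] →+* ℂ_[p] := (algebraMap ℚ_[p] ℂ_[p]).comp (algebraMap ℤ_[p] ℚ_[p]) with hιZ
  have hbd : ∀ (A : PowerSeries ℤ_[p]) (k : ℕ), ‖ιZ (PowerSeries.coeff k A)‖ ≤ 1 :=
    norm_algebraMap_coeff_le_one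
  -- `|ζ - 1| < 1`
  have hz : ‖ζ - 1‖ < 1 := norm_sub_one_lt_one_of_pow_prime_pow_eq_one (j := n + 1) hζ.pow_eq_one
  -- `p`-content and Weierstrass preparation: `G = p^m P U`
  obtain ⟨m, G', hGG', hG'⟩ := IwasawaAlgebra.exists_eq_C_pow_mul_and_map_residue_ne_zero p hG0
  set P : Polynomial ℤ_[p] := G'.weierstrassDistinguished hG' with hP
  set U : PowerSeries ℤ_[p] := G'.weierstrassUnit hG' with hU
  have hfac : G' = (P : PowerSeries ℤ_[p]) * U :=
    G'.eq_weierstrassDistinguished_mul_weierstrassUnit hG'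
  have hPmonic : P.Monic := (G'.isDistinguishedAt_weierstrassDistinguished hG').monic
  obtain ⟨V, hUV⟩ := (G'.isUnit_weierstrassUnit hG').exists_right_inv
  -- `G(ζ-1) = p^m P(ζ-1) U(ζ-1)` and `U(ζ-1) V(ζ-1) = 1`
  have hGeval : ∑' k, ιZ (PowerSeries.coeff k G) * (ζ - 1) ^ k =
      ιZ ((p : ℤ_[p]) ^ m) * (P.eval₂ ιZ (ζ - 1) * ∑' k, ιZ (PowerSeries.coeff k U) * (ζ - 1) ^ k) := by
    rw [hGG', tsum_map_coeff_mul_mul_pow ιZ (hbd _) (hbd _) hz,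
      (hasSum_map_coeff_C_mul_pow ιZ _ (ζ - 1)).tsum_eq, hfac,
      tsum_map_coeff_mul_mul_pow ιZ (hbd _) (hbd _) hz,
      (hasSum_map_coeff_coe_mul_pow ιZ P (ζ - 1)).tsum_eq]
  have hUV' : (∑' k, ιZ (PowerSeries.coeff k U) * (ζ - 1) ^ k) *
      ∑' k, ιZ (PowerSeries.coeff k V) * (ζ - 1) ^ k = 1 := by
    rw [← tsum_map_coeff_mul_mul_pow ιZ (hbd _) (hbd _) hz, hUV,
      (hasSum_map_coeff_one_mul_pow ιZ (ζ - 1)).tsum_eq]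
  have hUne : ∑' k, ιZ (PowerSeries.coeff k U) * (ζ - 1) ^ k ≠ 0 := left_ne_zero_of_mul_eq_one hUV'
  have hpm : ιZ ((p : ℤ_[p]) ^ m) ≠ 0 := by
    rw [map_pow, map_natCast]
    exact pow_ne_zero _ (Nat.cast_ne_zero.mpr hp.out.ne_zero)
  rw [hsum.tsum_eq] at hGeval
  have h1 := (mul_eq_zero.mp hGeval.symm).resolve_left hpm
  have hProot : P.eval₂ ιZ (ζ - 1) = 0 := (mul_eq_zero.mp h1).resolve_right hUne
  -- `deg P ≥ φ(p^{n+1})` and `deg P = λ(G)`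
  rw [lam_eq_natDegree_weierstrassDistinguished hGG' hG']
  exact totient_le_natDegree_of_isRoot hζ hPmonic.ne_zero (by rw [IsRoot.def, eval_map]; exact hProot)

/-- **Contrapositive: `λ(G) < φ(pⁿ⁺¹)` ⇒ `G(ζ − 1) ≠ 0`** for every primitive `pⁿ⁺¹`-th root of unity
`ζ ∈ ℂ_p` (`G ≠ 0`; the value is the sum of the convergent series `∑ G_k (ζ−1)^k`).
[cite: Washington1997, §7.1–7.2 and Thm. 7.3] -/
theorem tsum_ne_zero_of_lam_lt_totient {G : IwasawaAlgebra p} (hG0 : G ≠ 0) {n : ℕ}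
    (hlam : lam G < Nat.totient (p ^ (n + 1))) {ζ : ℂ_[p]} (hζ : IsPrimitiveRoot ζ (p ^ (n + 1))) :
    ∑' k, ((algebraMap ℚ_[p] ℂ_[p]).comp (algebraMap ℤ_[p] ℚ_[p])) (PowerSeries.coeff k G) *
      (ζ - 1) ^ k ≠ 0 := by
  intro h0
  have hz : ‖ζ - 1‖ < 1 := norm_sub_one_lt_one_of_pow_prime_pow_eq_one (j := n + 1) hζ.pow_eq_one
  have hs := (summable_map_coeff_mul_pow ((algebraMap ℚ_[p] ℂ_[p]).comp (algebraMap ℤ_[p] ℚ_[p]))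
    (norm_algebraMap_coeff_le_one G) hz).hasSum
  rw [h0] at hs
  exact absurd hlam (not_lt.mpr (totient_le_lam_of_hasSum_zero hG0 hζ hs))

/-- **`λ(G) < p − 1` ⇒ `G` vanishes at NO point `ζ − 1` with `ζ ∈ μ_{p^∞}`, `ζ ≠ 1`** (the order of
such a `ζ` is `p^{n+1}` for some `n`, and `φ(p^{n+1}) ≥ φ(p) = p − 1 > λ(G)`).
[cite: Washington1997, §7.1–7.2 and Thm. 7.3] -/
theorem tsum_ne_zero_of_lam_lt_sub_one {G : IwasawaAlgebra p} (hG0 : G ≠ 0) (hlam : lam G + 1 < p)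
    {ζ : ℂ_[p]} {j : ℕ} (hζj : ζ ^ p ^ j = 1) (hζ1 : ζ ≠ 1) :
    ∑' k, ((algebraMap ℚ_[p] ℂ_[p]).comp (algebraMap ℤ_[p] ℚ_[p])) (PowerSeries.coeff k G) *
      (ζ - 1) ^ k ≠ 0 := by
  -- the order of `ζ` is `p^{n+1}` for some `n`
  have hP : p.Prime := hp.out
  have hord : orderOf ζ ∣ p ^ j := orderOf_dvd_of_pow_eq_one hζj
  obtain ⟨i, -, hi⟩ := (Nat.dvd_prime_pow hP).mp hord
  have hi0 : i ≠ 0 := by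
    rintro rfl
    rw [pow_zero, orderOf_eq_one_iff] at hi
    exact hζ1 hi
  obtain ⟨n, rfl⟩ := Nat.exists_eq_succ_of_ne_zero hi0
  have hζ : IsPrimitiveRoot ζ (p ^ (n + 1)) := by rw [← hi]; exact IsPrimitiveRoot.orderOf ζ
  refine tsum_ne_zero_of_lam_lt_totient hG0 (lt_of_lt_of_le (b := Nat.totient (p ^ 1)) ?_ ?_) hζ
  · -- `λ(G) < p - 1 = φ(p)`
    rw [pow_one, Nat.totient_prime hP]
    omega
  · exact Nat.totient_dvd_of_dvd (pow_dvd_pow p (Nat.le_add_left 1 n)) |> Nat.le_of_dvd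
      (Nat.totient_pos.mpr (pow_pos hP.pos _))

end Zeros

end Summit.BirchSwinnertonDyer.Rank1Residual.Iwasawa

end
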